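import Mathlib
import Summits.NavierStokesRegularity.NavierStokesRegularity.Theorems.LerayQuarterDissipationFiniteDissipationLiouvilleAveragedVelocity
import HarnessLib

/-!
# Crux `FiniteDissipationLiouville` (stmt-NavierStokesRegularity-22144): THRESHOLD ONE ON AVERAGE in
# PHYSICAL time — `√(−t)‖V(t,x)‖ ≤ g(t)` with `∫_a^t √(−t)(−τ)^{−3/2} g(τ)² dτ ≤ Γ₂ < 2` forces
# `V ≡ 0` on the finite-dissipation stratum

Theorems file of route `LerayQuarterDissipation` (lead prover g16; `--supports` the crux; the
physical-variable form of `…AveragedVelocity.eq_zero_of_velocity_avg_lt`). Navier–Stokes regularity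
is NOT proved by anything here; no summit is.

The averaged rungs of `…AveragedRungs` / `…AveragedVelocity` are stated in similarity time
`σ = −log(−τ)` with the weight `e^{−(s−σ)/2}dσ`. Under `τ = −e^{−σ}` this weight is the probability
density `√(−t)·dτ/(2(−τ)^{3/2})` (times `2`) on `(−∞, t)`, `t = −e^{−s}`:

* `integral_exp_weight_comp_eq` — the substitution: for `h` continuous on `(−∞,0)` and `a' ≤ s`,
  `∫_{a'}^{s} e^{−(s−σ)/2} h(−e^{−σ}) dσ = ∫_{−e^{−a'}}^{−e^{−s}} √(e^{−s})/(√(−τ)·(−τ)) h(τ) dτ`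
  (`intervalIntegral.integral_comp_mul_deriv'` with `φ(σ) = −e^{−σ}`, `φ' = e^{−σ}`);
* **`eq_zero_of_velocity_physicalAvg_lt`** — a member of `𝒟_{C,K}` (any `C`, `K`) with a
  continuous majorant `√(−t)‖V(t,x)‖ ≤ g(t)` on `t < 0` (`g ≥ 0`) whose parabolic backward mean
  square obeys `∫_a^t √(−t)/(√(−τ)(−τ)) g(τ)² dτ ≤ Γ₂` for all `a ≤ t < 0`, with `Γ₂ < 2`, vanishes
  identically on `t < 0` (`g ≡ C`: `∫ = 2C²(1 − √(t/a)) ≤ 2C²`, i.e. `C < 1` — T31⁗ on the stratum);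
* `not_singular_of_velocity_physicalAvg_lt` — the regularity form in the quantifier shape of the crux:
  **a finite-dissipation Type-I singularity has `sup_{a<t<0} ∫_a^t √(−t)(−τ)^{−3/2}[(−τ)‖u(τ)‖²_∞]dτ ≥ 2`
  for every continuous majorant of its scale-invariant amplitude** — its Type-I amplitude is at least
  `1` in parabolic backward ROOT MEAN SQUARE, not merely in supremum.

HONEST FRAMING. A necessary condition on the HYPOTHETICAL singular profile; nothing is removed from
the catalogued DSS wall (`TypeIDSSLiouville`, NECESSARY for the crux); nothing here bears on
Navier–Stokes regularity or blow-up. References: KNSS 2009 §5; Tsai 1998; folklore.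
-/

noncomputable section

set_option linter.dupNamespace false

namespace Summit.NavierStokesRegularity.NavierStokesRegularity.Theorems.FiniteDissipationLiouville.Averaged

open MeasureTheory Set Filter Topology Metric InnerProductSpace Function Real
open scoped RealInnerProductSpace ContDiff ENNReal
open Literature.Analysis Literature.Analysis.FluidPDE
open Summit.NavierStokesRegularity.NavierStokesRegularity.Theorems
open Summit.NavierStokesRegularity.NavierStokesRegularity.Theorems.FiniteDissipationLiouville.VorticityLThree

variable {C : ℝ} {V : ℝ → (EuclideanSpace ℝ (Fin 3)) → (EuclideanSpace ℝ (Fin 3))}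

/-- **The substitution `τ = −e^{−σ}`.** For `h` continuous on `(−∞, 0)` and any `a', s`:
`∫_{a'}^{s} e^{−(s−σ)/2} h(−e^{−σ}) dσ = ∫_{−e^{−a'}}^{−e^{−s}} (√(e^{−s})/(√(−τ)·(−τ))) h(τ) dτ`.
[folklore] -/
theorem integral_exp_weight_comp_eq {h : ℝ → ℝ} (hh : ContinuousOn h (Set.Iio 0)) (a' s : ℝ) :
    ∫ σ in a'..s, Real.exp (-((1 / 2) * (s - σ))) * h (-Real.exp (-σ)) =
      ∫ τ in (-Real.exp (-a'))..(-Real.exp (-s)),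
        Real.sqrt (Real.exp (-s)) / (Real.sqrt (-τ) * (-τ)) * h τ := by
  set φ : ℝ → ℝ := fun σ => -Real.exp (-σ) with hφ
  set F : ℝ → ℝ := fun τ => Real.sqrt (Real.exp (-s)) / (Real.sqrt (-τ) * (-τ)) * h τ with hF
  have hφd : ∀ σ ∈ uIcc a' s, HasDerivAt φ (Real.exp (-σ)) σ := by
    intro σ _
    have h2 : HasDerivAt (fun x => -Real.exp (-x)) (-(Real.exp (-σ) * -1)) σ :=
      ((hasDerivAt_neg σ).exp).neg
    have e : -(Real.exp (-σ) * -1) = Real.exp (-σ) := by ring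
    rw [e] at h2
    exact h2
  have hφ' : ContinuousOn (fun σ => Real.exp (-σ)) (uIcc a' s) :=
    (Real.continuous_exp.comp continuous_neg).continuousOn
  have himg : φ '' uIcc a' s ⊆ Set.Iio 0 := by
    rintro τ ⟨σ, -, rfl⟩
    simp only [hφ, mem_Iio, neg_lt_zero]
    exact Real.exp_pos _
  have hFc : ContinuousOn F (Set.Iio 0) := by
    refine ContinuousOn.mul (ContinuousOn.div continuousOn_const ?_ ?_) hh
    · exact ((Real.continuous_sqrt.comp continuous_neg).mul continuous_neg).continuousOn
    · intro τ hτ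
      have hτ' : 0 < -τ := neg_pos.2 hτ
      exact mul_ne_zero (Real.sqrt_pos.2 hτ').ne' hτ'.ne'
  have key := intervalIntegral.integral_comp_mul_deriv' hφd hφ' (hFc.mono himg)
  -- identify the integrand on the left
  have hint : (fun σ => (F ∘ φ) σ * Real.exp (-σ)) =
      fun σ => Real.exp (-((1 / 2) * (s - σ))) * h (-Real.exp (-σ)) := by
    funext σ
    simp only [Function.comp, hF, hφ, neg_neg]
    have hexp : 0 < Real.exp (-σ) := Real.exp_pos _
    rw [sqrt_exp_neg, sqrt_exp_neg]
    have e : Real.exp (-s / 2) / (Real.exp (-σ / 2) * Real.exp (-σ)) * h (-Real.exp (-σ)) * Real.exp (-σ)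
        = Real.exp (-s / 2) / Real.exp (-σ / 2) * h (-Real.exp (-σ)) := by
      field_simp
    rw [e, ← Real.exp_sub]
    congr 2
    ring
  rw [hint] at key
  rw [key]

/-- **THRESHOLD ONE ON AVERAGE, physical time.** Let `V ∈ 𝒟_{C,K}` (any `C`, `K`), `g : ℝ → ℝ`
continuous on `(−∞,0)` with `0 ≤ g(t)` and `√(−t)‖V(t,x)‖ ≤ g(t)` for all `t < 0`, `x`, and
suppose `∫_a^t √(−t)/(√(−τ)·(−τ)) g(τ)² dτ ≤ Γ₂` for all `a ≤ t < 0`, with `Γ₂ < 2`. Then `V ≡ 0` on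
`t < 0` (`…AveragedVelocity.eq_zero_of_velocity_avg_lt` with `γ(σ) = g(−e^{−σ})` and the substitution
`integral_exp_weight_comp_eq`). [folklore energy method] -/
theorem eq_zero_of_velocity_physicalAvg_lt (hV : IsTypeIAncientMild C V) {K : ℝ}
    (hK : ∀ t : ℝ, t < 0 → ∫⁻ x, ‖fderiv ℝ (V t) x‖ₑ ^ 2 ≤ ENNReal.ofReal (K / Real.sqrt (-t)))
    {g : ℝ → ℝ} (hgc : ContinuousOn g (Set.Iio 0)) (hg0 : ∀ t : ℝ, t < 0 → 0 ≤ g t)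
    (hVg : ∀ t : ℝ, t < 0 → ∀ x, Real.sqrt (-t) * ‖V t x‖ ≤ g t)
    {Γ₂ : ℝ} (hΓ : ∀ a t : ℝ, a ≤ t → t < 0 →
      ∫ τ in a..t, Real.sqrt (-t) / (Real.sqrt (-τ) * (-τ)) * g τ ^ 2 ≤ Γ₂)
    (hΓlt : Γ₂ < 2) :
    ∀ t < 0, ∀ x, V t x = 0 := by
  set γ : ℝ → ℝ := fun σ => g (-Real.exp (-σ)) with hγdef
  have hφc : Continuous fun σ : ℝ => -Real.exp (-σ) := (Real.continuous_exp.comp continuous_neg).neg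
  have hφneg : ∀ σ : ℝ, -Real.exp (-σ) < 0 := fun σ => neg_neg_of_pos (Real.exp_pos _)
  have hγc : Continuous γ :=
    hgc.comp_continuous hφc fun σ => hφneg σ
  have hγ0 : ∀ σ, 0 ≤ γ σ := fun σ => hg0 _ (hφneg σ)
  have hU : ∀ σ y, ‖lerayOrbit V σ y‖ ≤ γ σ := by
    intro σ y
    rw [lerayOrbit_apply, norm_smul, Real.norm_of_nonneg (Real.exp_pos _).le]
    have h := hVg (-Real.exp (-σ)) (hφneg σ) (Real.exp (-σ / 2) • y)
    rwa [neg_neg, sqrt_exp_neg] at h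
  have hg2c : ContinuousOn (fun τ => g τ ^ 2) (Set.Iio 0) := hgc.pow 2
  have hΓ' : ∀ a' s : ℝ, a' ≤ s →
      ∫ σ in a'..s, Real.exp (-((1 / 2) * (s - σ))) * γ σ ^ 2 ≤ Γ₂ := by
    intro a' s has
    have e := integral_exp_weight_comp_eq (h := fun τ => g τ ^ 2) hg2c a' s
    simp only [hγdef]
    rw [e]
    have ht : -Real.exp (-s) < 0 := hφneg s
    have hle : -Real.exp (-a') ≤ -Real.exp (-s) := by
      have := Real.exp_le_exp.2 (neg_le_neg has)
      linarith
    have h := hΓ (-Real.exp (-a')) (-Real.exp (-s)) hle ht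
    rwa [neg_neg] at h
  exact eq_zero_of_velocity_avg_lt hV hK hγc hγ0 hU hΓ' hΓlt

/-- **Regularity form**: under the same hypotheses `V` is not singular at the space–time origin; i.e.
a SINGULAR member of the stratum has, for every continuous majorant `g` of `√(−t)‖V(t)‖_∞` and every
`Γ₂ < 2`, some `a ≤ t < 0` with `∫_a^t √(−t)(−τ)^{−3/2} g(τ)² dτ > Γ₂`. [folklore] -/
theorem not_singular_of_velocity_physicalAvg_lt (hV : IsTypeIAncientMild C V) {K : ℝ}
    (hK : ∀ t : ℝ, t < 0 → ∫⁻ x, ‖fderiv ℝ (V t) x‖ₑ ^ 2 ≤ ENNReal.ofReal (K / Real.sqrt (-t)))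
    {g : ℝ → ℝ} (hgc : ContinuousOn g (Set.Iio 0)) (hg0 : ∀ t : ℝ, t < 0 → 0 ≤ g t)
    (hVg : ∀ t : ℝ, t < 0 → ∀ x, Real.sqrt (-t) * ‖V t x‖ ≤ g t)
    {Γ₂ : ℝ} (hΓ : ∀ a t : ℝ, a ≤ t → t < 0 →
      ∫ τ in a..t, Real.sqrt (-t) / (Real.sqrt (-τ) * (-τ)) * g τ ^ 2 ≤ Γ₂)
    (hΓlt : Γ₂ < 2) :
    ¬ (∀ r > 0, ∀ M : ℝ, ∃ t ∈ Set.Ioo (-(r ^ 2)) (0 : ℝ),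
        ∃ x ∈ Metric.ball (0 : EuclideanSpace ℝ (Fin 3)) r, M < ‖V t x‖) := by
  intro hsing
  obtain ⟨t, ht, x, -, hM⟩ := hsing 1 one_pos 0
  have h0 := eq_zero_of_velocity_physicalAvg_lt hV hK hgc hg0 hVg hΓ hΓlt t ht.2 x
  rw [h0, norm_zero] at hM
  exact lt_irrefl _ hM

end Summit.NavierStokesRegularity.NavierStokesRegularity.Theorems.FiniteDissipationLiouville.Averaged

end
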